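import Mathlib
import Literature.Analysis.FluidPDE.PassiveScalarWellPosedness
import Literature.Analysis.FluidPDE.PassiveScalarClassicalEnergy
import Summits.AnomalousDissipation.AnomalousDissipation.Theorems.TwoAndHalfDScalarAnomalySteadySourceFormalColdStartVarianceToolkit
import Summits.AnomalousDissipation.AnomalousDissipation.Theorems.TwoAndHalfDTwohalfdThesisStubDuhamelVariance

/-!
# T3 `stub_meanSquareDuhamelVariance`: integrated variance from mean-square release decay

Stub T3 of the line `budgeted-mixer-template` (reshape r2) for the crux
`Summit.AnomalousDissipation.AnomalousDissipation.Theses.TwoAndHalfD.ScalarAnomalySteadySourceFormal`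
(stmt-AnomalousDissipation-0448); the statement is registered verbatim in the line's checked
skeleton and is consumed by the kernel-checked composition there.

CONTENT.  Let `κ > 0`, `h` smooth, `θ` the classical cold start of the steadily sourced scalar
(`∂ₜθ + u·∇θ = κΔθ + h` on `[0, ∞) × T²`, `θ(0) = 0`) and `φ s` the classical release of the datum
`h` at time `s ≥ 0` (unforced equation on `[s, ∞)`).  Assume the weak Duhamel identity
`∫ θ(t) χ = ∫₀ᵗ (∫ φ s (t) χ) ds` for smooth `χ` (landed stub D0), a Borel measurable `G` agreeing
with `‖φ s (t)‖²_{L²}` on `0 ≤ s ≤ t` (stub T3a), an antitone rate `m > 0` with `∫₀ᵗ m ≤ M`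
(`t ≥ 0`), `s₀, B ≥ 0`, and the MEAN-SQUARE decay
`∫_{s₀}^{T} ‖φ s (s + τ)‖² ds ≤ (B + (T - s₀)) m(τ)² ‖h‖²` (`τ ≥ 0`, `T ≥ s₀`).  Then for every
`T ≥ 0`: `∫₀ᵀ ‖θ(t)‖²_{L²} dt ≤ (2 s₀² T + 2 M² (B + T)) ‖h‖²_{L²}`.

PROOF.  Write `N = ‖h‖²`; releases do not grow (`IsClassicalScalarTransportOn.antitoneOn_scalarL2Sq`),
so `0 ≤ G ≤ N` on `0 ≤ s ≤ t`, and `M ≥ ∫₀¹ m ≥ m(1) > 0`.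
* `sq_le_of_duhamel_amgm` (pointwise in `t`): `χ := θ(t)` in the identity and Cauchy–Schwarz in
  `x` (`TwohalfdThesis.abs_integral_mul_le`) give `‖θ(t)‖² ≤ ‖θ(t)‖ ∫₀ᵗ √G(s,t) ds`
  (`intervalIntegral.norm_integral_le_of_norm_le`, no integrability of the pairing needed); the
  releases before `s₀` contribute `≤ s₀ √N ‖θ(t)‖ ≤ ‖θ(t)‖²/4 + s₀² N`, and after `s = t - τ` the
  weighted AM–GM `‖θ‖ √G ≤ ‖θ‖² m(τ)/(4M) + M G/m(τ)` bounds the late ones by `‖θ(t)‖²/4 + M J(t)`,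
  `J(t) := ∫_{(0, t-s₀]} G(t-τ,t)/m(τ) dτ`.  Hence `‖θ(t)‖² ≤ 2 s₀² N + 2 M J(t)` (`t ≥ 0`).
* `integral_weightedRelease_le` (Tonelli bookkeeping): `G(t-τ,t)/m(τ)` on the triangle
  `{0 < t ≤ T, 0 < τ ≤ t - s₀}` is measurable and bounded by `N/m(T)`, so Fubini
  (`integral_integral_swap`) gives `∫₀ᵀ J = ∫ dτ m(τ)⁻¹ ∫_{s₀+τ}^{T} G(t-τ,t) dt`, and the
  `t`-section equals `m(τ)⁻¹ ∫_{s₀}^{T-τ} G(s,s+τ) ds ≤ (B + T) N m(τ)` by the mean-square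
  hypothesis; thus `∫₀ᵀ J ≤ (B + T) N M` and `∫₀ᵀ ‖θ‖² ≤ 2 s₀² N T + 2 M (B + T) N M`.
Supports stmt-AnomalousDissipation-0448. [folklore: Duhamel's principle (Evans 2010, §2.3.1 (c)) +
Green–Kubo bookkeeping; Fubini–Tonelli]
-/

noncomputable section

-- the summit path `AnomalousDissipation/AnomalousDissipation` duplicates a namespace component
set_option linter.dupNamespace false

namespace Summit.AnomalousDissipation.AnomalousDissipation.Theorems.ScalarAnomalySteadySourceFormal.MeanSquareDuhamelVariance

open MeasureTheory Set Filter Topology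
open scoped ENNReal NNReal
open Literature.Analysis.FunctionSpaces Literature.Analysis.FluidPDE

/-! ## Real-variable lemmas -/

/-- A measurable real function bounded on `(a, b]`, `a ≤ b`, is interval integrable on `[a, b]`
(domination by a constant, `IntervalIntegrable.mono_fun'`). [folklore] -/
theorem intervalIntegrable_of_abs_le {f : ℝ → ℝ} {a b C : ℝ} (hab : a ≤ b) (hf : Measurable f)
    (h : ∀ x ∈ Ioc a b, |f x| ≤ C) : IntervalIntegrable f volume a b := by
  have hle : ∀ᵐ x ∂(volume.restrict (uIoc a b)), ‖f x‖ ≤ C := by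
    rw [uIoc_of_le hab, ae_restrict_iff' measurableSet_Ioc]
    exact ae_of_all _ fun x hx => by rw [Real.norm_eq_abs]; exact h x hx
  exact intervalIntegrable_const.mono_fun' hf.aestronglyMeasurable hle

/-- Weighted AM–GM: `√g · b ≤ b² w / (4M) + M g / w` for `w, M > 0`, `g ≥ 0`
(`(b w - 2 M √g)² ≥ 0`). [folklore] -/
theorem mul_sqrt_le_weighted {b g w M : ℝ} (hg : 0 ≤ g) (hw : 0 < w) (hM : 0 < M) :
    √g * b ≤ b ^ 2 / (4 * M) * w + M * (g / w) := by
  obtain ⟨r, hr, rfl⟩ : ∃ r, 0 ≤ r ∧ r ^ 2 = g := ⟨√g, Real.sqrt_nonneg _, Real.sq_sqrt hg⟩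
  rw [Real.sqrt_sq hr]
  have h4 : 0 < 4 * M * w := by positivity
  rw [show b ^ 2 / (4 * M) * w + M * (r ^ 2 / w) = ((b * w) ^ 2 + 4 * M ^ 2 * r ^ 2) / (4 * M * w)
    by field_simp]
  rw [le_div_iff₀ h4]
  nlinarith [sq_nonneg (b * w - 2 * M * r)]

/-- **Tonelli bookkeeping on the release triangle.**  Let `G` be Borel measurable on the plane with
`0 ≤ G(s,t) ≤ N` for `0 ≤ s ≤ t`, `m > 0` antitone with `∫₀ᵗ m ≤ M` (`t ≥ 0`), `s₀, B, N, T ≥ 0`,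
and assume the mean-square bound in the form
`∫_{s₀}^{T-τ} G(s, s+τ) ds ≤ (B + (T - τ - s₀)) m(τ)² N` for `0 < τ`, `s₀ + τ ≤ T`.  Then the
weighted Duhamel integral `J(t) = ∫_{(0, t-s₀]} G(t-τ,t)/m(τ) dτ` is integrable on `(0, T]` and
`∫_{(0,T]} J ≤ (B + T) N M`: the integrand on the triangle `{0 < t ≤ T, 0 < τ ≤ t - s₀}` is
measurable and bounded by `N / m(T)`, Fubini swaps the integrals, the `t`-section at lag `τ` is
`m(τ)⁻¹ ∫_{s₀+τ}^{T} G(t-τ,t) dt = m(τ)⁻¹ ∫_{s₀}^{T-τ} G(s,s+τ) ds ≤ (B + T) N m(τ)`, and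
`∫₀^{T-s₀} m ≤ M`. [folklore] -/
theorem integral_weightedRelease_le {G : ℝ × ℝ → ℝ} {m : ℝ → ℝ} {s₀ B M N T : ℝ}
    (hG : Measurable G) (hanti : Antitone m) (hpos : ∀ τ, 0 < m τ)
    (hM : ∀ t, 0 ≤ t → ∫ τ in (0 : ℝ)..t, m τ ≤ M)
    (hGnn : ∀ s t, 0 ≤ s → s ≤ t → 0 ≤ G (s, t)) (hGle : ∀ s t, 0 ≤ s → s ≤ t → G (s, t) ≤ N)
    (hMS : ∀ τ, 0 < τ → s₀ + τ ≤ T →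
      ∫ s in s₀..T - τ, G (s, s + τ) ≤ (B + (T - τ - s₀)) * m τ ^ 2 * N)
    (hs₀ : 0 ≤ s₀) (hB : 0 ≤ B) (hN : 0 ≤ N) (hT : 0 ≤ T) :
    IntegrableOn (fun t => ∫ τ in Ioc 0 (t - s₀), G (t - τ, t) / m τ) (Ioc 0 T) ∧
      ∫ t in Ioc 0 T, (∫ τ in Ioc 0 (t - s₀), G (t - τ, t) / m τ) ≤ (B + T) * N * M := by
  have hM0 : 0 ≤ M := by simpa using hM 0 le_rfl
  -- the triangle and the integrand
  obtain ⟨R, hR⟩ : ∃ R : Set (ℝ × ℝ), R = {p | p.1 ∈ Ioc 0 T ∧ p.2 ∈ Ioc 0 (p.1 - s₀)} :=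
    ⟨_, rfl⟩
  have hmemR : ∀ t τ, (t, τ) ∈ R ↔ t ∈ Ioc 0 T ∧ τ ∈ Ioc 0 (t - s₀) := fun t τ => by
    rw [hR]; exact Iff.rfl
  have hRm : MeasurableSet R := by
    have e : R = Prod.fst ⁻¹' Ioc 0 T ∩ ({p : ℝ × ℝ | 0 < p.2} ∩ {p : ℝ × ℝ | p.2 ≤ p.1 - s₀}) := by
      rw [hR]; ext p; simp only [mem_setOf_eq, mem_inter_iff, mem_preimage, mem_Ioc]
    rw [e]
    exact (measurable_fst measurableSet_Ioc).inter
      ((measurableSet_lt measurable_const measurable_snd).inter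
        (measurableSet_le measurable_snd (measurable_fst.sub measurable_const)))
  have hf₀m : Measurable fun p : ℝ × ℝ => G (p.1 - p.2, p.1) / m p.2 :=
    (hG.comp ((measurable_fst.sub measurable_snd).prodMk measurable_fst)).div
      (hanti.measurable.comp measurable_snd)
  obtain ⟨F, hF⟩ : ∃ F : ℝ × ℝ → ℝ, F = R.indicator fun p => G (p.1 - p.2, p.1) / m p.2 :=
    ⟨_, rfl⟩
  -- bounds on the triangle
  have hf₀R : ∀ p ∈ R, 0 ≤ G (p.1 - p.2, p.1) / m p.2 ∧ G (p.1 - p.2, p.1) / m p.2 ≤ N / m T := by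
    rintro ⟨t, τ⟩ hp
    obtain ⟨⟨_, htT⟩, hτ0, hτt⟩ := (hmemR t τ).1 hp
    exact ⟨div_nonneg (hGnn _ _ (by linarith) (by linarith)) (hpos τ).le,
      div_le_div₀ hN (hGle _ _ (by linarith) (by linarith)) (hpos T) (hanti (by linarith))⟩
  have hF0 : ∀ p, 0 ≤ F p := fun p => by
    rw [hF]; exact Set.indicator_nonneg (fun p hp => (hf₀R p hp).1) p
  -- integrability on the plane
  have hRsub : R ⊆ Ioc 0 T ×ˢ Ioc 0 (T - s₀) := by
    rintro ⟨t, τ⟩ hp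
    obtain ⟨⟨ht0, htT⟩, hτ0, hτt⟩ := (hmemR t τ).1 hp
    exact ⟨⟨ht0, htT⟩, hτ0, by linarith⟩
  have hRfin : ((volume : Measure ℝ).prod volume) R ≠ ∞ := by
    refine (lt_of_le_of_lt (measure_mono hRsub) ?_).ne
    rw [Measure.prod_prod, Real.volume_Ioc, Real.volume_Ioc]
    exact ENNReal.mul_lt_top ENNReal.ofReal_lt_top ENNReal.ofReal_lt_top
  have hFi : Integrable F ((volume : Measure ℝ).prod volume) := by
    rw [hF, integrable_indicator_iff hRm]
    refine Measure.integrableOn_of_bounded (M := N / m T) hRfin hf₀m.aestronglyMeasurable ?_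
    refine (ae_restrict_iff' hRm).2 (ae_of_all _ fun p hp => ?_)
    rw [Real.norm_eq_abs, abs_of_nonneg (hf₀R p hp).1]
    exact (hf₀R p hp).2
  -- `t`-sections: the weighted Duhamel integral
  have hJ_eq : ∀ t ∈ Ioc 0 T, ∫ τ, F (t, τ) = ∫ τ in Ioc 0 (t - s₀), G (t - τ, t) / m τ := by
    intro t ht
    rw [← integral_indicator measurableSet_Ioc]
    refine integral_congr_ae (ae_of_all _ fun τ => ?_)
    dsimp only
    rw [hF]
    by_cases hτ : τ ∈ Ioc 0 (t - s₀)
    · rw [indicator_of_mem hτ, indicator_of_mem ((hmemR t τ).2 ⟨ht, hτ⟩)]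
    · rw [indicator_of_notMem hτ, indicator_of_notMem (fun hp => hτ ((hmemR t τ).1 hp).2)]
  have hJ_zero : ∀ t, t ∉ Ioc 0 T → ∫ τ, F (t, τ) = 0 := by
    intro t ht
    have h0 : ∀ τ, F (t, τ) = 0 := fun τ =>
      hF ▸ indicator_of_notMem (fun hp => ht ((hmemR t τ).1 hp).1) _
    simp [h0]
  have hJi : IntegrableOn (fun t => ∫ τ in Ioc 0 (t - s₀), G (t - τ, t) / m τ) (Ioc 0 T) :=
    hFi.integral_prod_left.integrableOn.congr_fun (fun t ht => hJ_eq t ht) measurableSet_Ioc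
  have hswap : ∫ t in Ioc 0 T, (∫ τ in Ioc 0 (t - s₀), G (t - τ, t) / m τ) =
      ∫ τ, ∫ t, F (t, τ) :=
    calc ∫ t in Ioc 0 T, (∫ τ in Ioc 0 (t - s₀), G (t - τ, t) / m τ)
        = ∫ t in Ioc 0 T, ∫ τ, F (t, τ) :=
          (setIntegral_congr_fun measurableSet_Ioc fun t ht => hJ_eq t ht).symm
      _ = ∫ t, ∫ τ, F (t, τ) := setIntegral_eq_integral_of_forall_compl_eq_zero hJ_zero
      _ = ∫ τ, ∫ t, F (t, τ) := integral_integral_swap hFi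
  -- `τ`-sections: the mean-square hypothesis
  have hτ_zero : ∀ τ, τ ∉ Ioc 0 (T - s₀) → ∀ t, F (t, τ) = 0 := by
    intro τ hτ t
    rw [hF]
    refine indicator_of_notMem (fun hp => hτ ?_) _
    obtain ⟨⟨_, htT⟩, hτ0, hτt⟩ := (hmemR t τ).1 hp
    exact ⟨hτ0, by linarith⟩
  have hinner : ∀ τ ∈ Ioc 0 (T - s₀), ∫ t, F (t, τ) ≤ (B + T) * N * m τ := by
    rintro τ ⟨hτ0, hτT⟩
    have hτs : s₀ + τ ≤ T := by linarith
    have hFτ : ∀ t, F (t, τ) = (Icc (s₀ + τ) T).indicator (fun t => G (t - τ, t) / m τ) t := by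
      intro t
      rw [hF]
      by_cases ht : t ∈ Icc (s₀ + τ) T
      · rw [indicator_of_mem ht,
          indicator_of_mem ((hmemR t τ).2 ⟨⟨by linarith [ht.1], ht.2⟩, hτ0, by linarith [ht.1]⟩)]
      · rw [indicator_of_notMem ht]
        refine indicator_of_notMem (fun hp => ht ?_) _
        obtain ⟨⟨_, htT⟩, _, hτt⟩ := (hmemR t τ).1 hp
        exact ⟨by linarith, htT⟩
    have hsub : ∫ s in s₀..T - τ, G (s, s + τ) = ∫ t in s₀ + τ..T, G (t - τ, t) := by
      have h := intervalIntegral.integral_comp_add_right (fun t => G (t - τ, t)) (a := s₀)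
        (b := T - τ) τ
      simp only [add_sub_cancel_right, sub_add_cancel] at h
      exact h
    have hm0 : m τ ≠ 0 := (hpos τ).ne'
    simp_rw [hFτ]
    rw [integral_indicator measurableSet_Icc, integral_Icc_eq_integral_Ioc,
      ← intervalIntegral.integral_of_le hτs, intervalIntegral.integral_div, ← hsub]
    calc (∫ s in s₀..T - τ, G (s, s + τ)) / m τ ≤ ((B + (T - τ - s₀)) * m τ ^ 2 * N) / m τ :=
          div_le_div_of_nonneg_right (hMS τ hτ0 hτs) (hpos τ).le
      _ = (B + (T - τ - s₀)) * N * m τ := by field_simp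
      _ ≤ (B + T) * N * m τ := by
          nlinarith [mul_nonneg (mul_nonneg (by linarith : 0 ≤ τ + s₀) hN) (hpos τ).le]
  -- the lag integral of the rate
  have hmi : IntegrableOn m (Ioc 0 (T - s₀)) :=
    ((hanti.antitoneOn _).integrableOn_isCompact isCompact_Icc).mono_set Ioc_subset_Icc_self
  have hmI : ∫ τ in Ioc 0 (T - s₀), m τ ≤ M := by
    rcases le_or_gt s₀ T with h | h
    · rw [← intervalIntegral.integral_of_le (sub_nonneg.2 h)]
      exact hM _ (sub_nonneg.2 h)
    · rw [Ioc_eq_empty (by intro h'; linarith)]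
      simp [hM0]
  have houter : ∫ τ, ∫ t, F (t, τ) ≤ (B + T) * N * M := by
    rw [← setIntegral_eq_integral_of_forall_compl_eq_zero (s := Ioc 0 (T - s₀))
      (fun τ hτ => by simp [hτ_zero τ hτ])]
    calc ∫ τ in Ioc 0 (T - s₀), ∫ t, F (t, τ) ≤ ∫ τ in Ioc 0 (T - s₀), (B + T) * N * m τ := by
          refine integral_mono_of_nonneg (ae_of_all _ fun τ => integral_nonneg fun t => hF0 _)
            (hmi.const_mul _) ?_
          exact (ae_restrict_iff' measurableSet_Ioc).2 (ae_of_all _ hinner)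
      _ = (B + T) * N * ∫ τ in Ioc 0 (T - s₀), m τ := integral_const_mul _ _
      _ ≤ (B + T) * N * M := mul_le_mul_of_nonneg_left hmI (mul_nonneg (add_nonneg hB hT) hN)
  exact ⟨hJi, hswap.trans_le houter⟩

/-- **Pointwise bound under the Duhamel integral.**  Let `0 ≤ G ≤ N` on `0 ≤ s ≤ t` be measurable,
`m > 0` antitone with `∫₀ᵗ m ≤ M`, `M > 0`, `s₀, t ≥ 0`, `Bt ≥ 0` with `Bt² = ∫₀ᵗ P` and
`|P s| ≤ √G(s,t) · Bt` on `(0, t]`.  Then `Bt² ≤ 2 s₀² N + 2 M ∫_{(0, t-s₀]} G(t-τ,t)/m(τ) dτ`: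
`Bt² ≤ ∫₀ᵗ √G(·,t) Bt` (`norm_integral_le_of_norm_le`), the part over `[0, min s₀ t]` is
`≤ s₀ √N Bt ≤ Bt²/4 + s₀² N`, and for `t > s₀` the part over `[s₀, t]` is, after `s = t - τ` and
the weighted AM–GM inequality, `≤ Bt²/(4M) ∫₀^{t-s₀} m + M J ≤ Bt²/4 + M J`. [folklore] -/
theorem sq_le_of_duhamel_amgm {P : ℝ → ℝ} {G : ℝ × ℝ → ℝ} {m : ℝ → ℝ} {s₀ M N Bt t : ℝ}
    (hG : Measurable G) (hanti : Antitone m) (hpos : ∀ τ, 0 < m τ)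
    (hM : ∀ t, 0 ≤ t → ∫ τ in (0 : ℝ)..t, m τ ≤ M) (hMpos : 0 < M)
    (hGnn : ∀ s t, 0 ≤ s → s ≤ t → 0 ≤ G (s, t)) (hGle : ∀ s t, 0 ≤ s → s ≤ t → G (s, t) ≤ N)
    (hs₀ : 0 ≤ s₀) (hN : 0 ≤ N) (ht : 0 ≤ t) (hBt : 0 ≤ Bt)
    (hrep : Bt ^ 2 = ∫ s in (0 : ℝ)..t, P s)
    (hP : ∀ s, 0 < s → s ≤ t → |P s| ≤ √(G (s, t)) * Bt) :
    Bt ^ 2 ≤ 2 * s₀ ^ 2 * N + 2 * M * ∫ τ in Ioc 0 (t - s₀), G (t - τ, t) / m τ := by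
  set J := ∫ τ in Ioc 0 (t - s₀), G (t - τ, t) / m τ with hJ
  have hJ0 : 0 ≤ J := setIntegral_nonneg measurableSet_Ioc fun τ hτ =>
    div_nonneg (hGnn _ _ (by linarith [hτ.2]) (by linarith [hτ.1])) (hpos τ).le
  have hsN : (s₀ * √N) ^ 2 = s₀ ^ 2 * N := by rw [mul_pow, Real.sq_sqrt hN]
  have hGs : Measurable fun s => G (s, t) := hG.comp measurable_prodMk_right
  have hGτ : Measurable fun τ => G (t - τ, t) :=
    hG.comp ((measurable_const.sub measurable_id).prodMk measurable_const)
  -- Step 1: Cauchy–Schwarz under the Duhamel integral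
  have hgi : IntervalIntegrable (fun s => √(G (s, t)) * Bt) volume 0 t := by
    refine intervalIntegrable_of_abs_le ht (hGs.sqrt.mul_const _) (C := √N * Bt) fun s hs => ?_
    rw [abs_of_nonneg (mul_nonneg (Real.sqrt_nonneg _) hBt)]
    exact mul_le_mul_of_nonneg_right (Real.sqrt_le_sqrt (hGle s t hs.1.le hs.2)) hBt
  have h1 : Bt ^ 2 ≤ ∫ s in (0 : ℝ)..t, √(G (s, t)) * Bt := by
    have h := intervalIntegral.norm_integral_le_of_norm_le ht
      (ae_of_all _ fun s hs => by rw [Real.norm_eq_abs]; exact hP s hs.1 hs.2) hgi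
    rw [← hrep, Real.norm_eq_abs] at h
    exact (le_abs_self _).trans h
  -- early releases
  have hearly : ∀ c, 0 ≤ c → c ≤ t → ∫ s in (0 : ℝ)..c, √(G (s, t)) * Bt ≤ √N * Bt * c := by
    intro c hc hct
    have h := intervalIntegral.norm_integral_le_of_norm_le_const (a := 0) (b := c) (C := √N * Bt)
      (f := fun s => √(G (s, t)) * Bt) fun s hs => by
        rw [uIoc_of_le hc] at hs
        rw [Real.norm_eq_abs, abs_of_nonneg (mul_nonneg (Real.sqrt_nonneg _) hBt)]
        exact mul_le_mul_of_nonneg_right (Real.sqrt_le_sqrt (hGle s t hs.1.le (hs.2.trans hct)))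
          hBt
    rw [Real.norm_eq_abs, sub_zero, abs_of_nonneg hc] at h
    exact (le_abs_self _).trans h
  rcases le_or_gt t s₀ with hts | hst
  · -- `t ≤ s₀`: only early releases
    have h2 := hearly t ht le_rfl
    have h3 : √N * Bt * t ≤ √N * Bt * s₀ :=
      mul_le_mul_of_nonneg_left hts (mul_nonneg (Real.sqrt_nonneg _) hBt)
    nlinarith [sq_nonneg (Bt - s₀ * √N), hsN, sq_nonneg Bt, mul_nonneg hMpos.le hJ0]
  · -- `s₀ < t`: split at `s₀`
    have hgi1 : IntervalIntegrable (fun s => √(G (s, t)) * Bt) volume 0 s₀ :=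
      hgi.mono_set (by rw [uIcc_of_le hs₀, uIcc_of_le ht]; exact Icc_subset_Icc le_rfl hst.le)
    have hgi2 : IntervalIntegrable (fun s => √(G (s, t)) * Bt) volume s₀ t :=
      hgi.mono_set (by rw [uIcc_of_le hst.le, uIcc_of_le ht]; exact Icc_subset_Icc hs₀ le_rfl)
    have h2 := hearly s₀ hs₀ hst.le
    have hd : 0 ≤ t - s₀ := sub_nonneg.2 hst.le
    have h3 : ∫ s in s₀..t, √(G (s, t)) * Bt ≤ Bt ^ 2 / 4 + M * J := by
      have hsub : ∫ s in s₀..t, √(G (s, t)) * Bt =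
          ∫ τ in (0 : ℝ)..t - s₀, √(G (t - τ, t)) * Bt := by
        have h := intervalIntegral.integral_comp_sub_left (fun τ => √(G (t - τ, t)) * Bt)
          (a := s₀) (b := t) t
        simp only [sub_sub_cancel, sub_self] at h
        exact h
      have hreg : ∀ τ ∈ Icc 0 (t - s₀), 0 ≤ t - τ ∧ t - τ ≤ t := fun τ hτ =>
        ⟨by linarith [hτ.2], by linarith [hτ.1]⟩
      have hτi : IntervalIntegrable (fun τ => √(G (t - τ, t)) * Bt) volume 0 (t - s₀) := by
        refine intervalIntegrable_of_abs_le hd (hGτ.sqrt.mul_const _) (C := √N * Bt) fun τ hτ => ?_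
        obtain ⟨h0, hle⟩ := hreg τ (Ioc_subset_Icc_self hτ)
        rw [abs_of_nonneg (mul_nonneg (Real.sqrt_nonneg _) hBt)]
        exact mul_le_mul_of_nonneg_right (Real.sqrt_le_sqrt (hGle _ _ h0 hle)) hBt
      have hmi : IntervalIntegrable m volume 0 (t - s₀) := hanti.intervalIntegrable
      have hqi : IntervalIntegrable (fun τ => G (t - τ, t) / m τ) volume 0 (t - s₀) := by
        refine intervalIntegrable_of_abs_le hd (hGτ.div hanti.measurable) (C := N / m (t - s₀))
          fun τ hτ => ?_
        obtain ⟨h0, hle⟩ := hreg τ (Ioc_subset_Icc_self hτ)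
        rw [abs_of_nonneg (div_nonneg (hGnn _ _ h0 hle) (hpos τ).le)]
        exact div_le_div₀ hN (hGle _ _ h0 hle) (hpos _) (hanti hτ.2)
      have hmono : ∫ τ in (0 : ℝ)..t - s₀, √(G (t - τ, t)) * Bt ≤
          ∫ τ in (0 : ℝ)..t - s₀, (Bt ^ 2 / (4 * M) * m τ + M * (G (t - τ, t) / m τ)) :=
        intervalIntegral.integral_mono_on hd hτi ((hmi.const_mul _).add (hqi.const_mul _))
          fun τ hτ => mul_sqrt_le_weighted (hGnn _ _ (hreg τ hτ).1 (hreg τ hτ).2) (hpos τ) hMpos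
      have hJ' : ∫ τ in (0 : ℝ)..t - s₀, G (t - τ, t) / m τ = J :=
        intervalIntegral.integral_of_le hd
      rw [hsub]
      refine hmono.trans ?_
      rw [intervalIntegral.integral_add (hmi.const_mul _) (hqi.const_mul _),
        intervalIntegral.integral_const_mul, intervalIntegral.integral_const_mul, hJ']
      have h5 : Bt ^ 2 / (4 * M) * ∫ τ in (0 : ℝ)..t - s₀, m τ ≤ Bt ^ 2 / (4 * M) * M :=
        mul_le_mul_of_nonneg_left (hM (t - s₀) hd) (by positivity)
      have h6 : Bt ^ 2 / (4 * M) * M = Bt ^ 2 / 4 := by field_simp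
      linarith
    have h4 := intervalIntegral.integral_add_adjacent_intervals hgi1 hgi2
    nlinarith [sq_nonneg (Bt / 2 - s₀ * √N), hsN, sq_nonneg Bt]

/-! ## The stub -/

/-- **T3 `stub_meanSquareDuhamelVariance` (line `budgeted-mixer-template`, reshape r2, crux
`TwoAndHalfD.ScalarAnomalySteadySourceFormal`).**  For `κ > 0`, smooth `h`, the classical cold start
`θ` of `∂ₜθ + u·∇θ = κΔθ + h` on `[0, ∞)`, the classical releases `φ s` of `h` (`s ≥ 0`), the weak
Duhamel identity, a Borel measurable `G` agreeing with `‖φ s (t)‖²` on `0 ≤ s ≤ t`, an antitone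
`m > 0` with `∫₀ᵗ m ≤ M` (`t ≥ 0`), `s₀, B ≥ 0` and the MEAN-SQUARE release decay
`∫_{s₀}^{T} ‖φ s (s+τ)‖² ds ≤ (B + (T − s₀)) m(τ)²‖h‖²` (`τ ≥ 0`, `T ≥ s₀`), one has for every
`T ≥ 0`: `∫₀ᵀ ‖θ(t)‖²_{L²} dt ≤ (2 s₀² T + 2 M² (B + T)) ‖h‖²_{L²}` (`sq_le_of_duhamel_amgm` with
`Bt = ‖θ(t)‖`, `P s = ∫ φ s (t) θ(t)`, Cauchy–Schwarz and the contraction `antitoneOn_scalarL2Sq`;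
then `integral_weightedRelease_le` and integration over `[0, T]`). [folklore] -/
theorem stub_meanSquareDuhamelVariance :
    ∀ (κ s₀ B M : ℝ) (u : ℝ → UnitAddTorus (Fin 2) → EuclideanSpace ℝ (Fin 2)) (h : UnitAddTorus (Fin 2) → ℝ)
      (θ : ℝ → UnitAddTorus (Fin 2) → ℝ) (φ : ℝ → ℝ → UnitAddTorus (Fin 2) → ℝ) (m : ℝ → ℝ) (G : ℝ × ℝ → ℝ),
      0 < κ → Torus.IsSmooth h →
      Torus.IsClassicalScalarTransportForcedOn (Set.Ici 0) κ u (fun _ => h) θ → θ 0 = (fun _ => (0 : ℝ)) →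
      (∀ s, 0 ≤ s → Torus.IsClassicalScalarTransportOn (Set.Ici s) κ u (φ s) ∧ φ s s = h) →
      (∀ χ : UnitAddTorus (Fin 2) → ℝ, Torus.IsSmooth χ → ∀ t, 0 ≤ t →
          ∫ x, θ t x * χ x = ∫ s in (0 : ℝ)..t, ∫ x, φ s t x * χ x) →
      Measurable G → (∀ s t, 0 ≤ s → s ≤ t → G (s, t) = Torus.scalarL2Sq (φ s t)) →
      0 ≤ s₀ → 0 ≤ B → Antitone m → (∀ τ, 0 < m τ) → (∀ t, 0 ≤ t → ∫ τ in (0 : ℝ)..t, m τ ≤ M) →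
      (∀ τ T, 0 ≤ τ → s₀ ≤ T →
          ∫ s in s₀..T, Torus.scalarL2Sq (φ s (s + τ)) ≤ (B + (T - s₀)) * m τ ^ 2 * Torus.scalarL2Sq h) →
      ∀ T, 0 ≤ T →
        ∫ t in (0 : ℝ)..T, Torus.scalarL2Sq (θ t) ≤ (2 * s₀ ^ 2 * T + 2 * M ^ 2 * (B + T)) * Torus.scalarL2Sq h := by
  intro κ s₀ B M u h θ φ m G hκ _ hθ _ hφ hId hGm hGeq hs₀ hB hanti hpos hM hMS T hT
  -- Step 0: signs, `M > 0`, contraction of the releases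
  have hN : 0 ≤ Torus.scalarL2Sq h := Torus.scalarL2Sq_nonneg _
  have hMpos : 0 < M := by
    have h1 : ∫ _ in (0 : ℝ)..1, m 1 ≤ ∫ τ in (0 : ℝ)..1, m τ :=
      intervalIntegral.integral_mono_on zero_le_one intervalIntegrable_const hanti.intervalIntegrable
        fun τ hτ => hanti hτ.2
    rw [intervalIntegral.integral_const, sub_zero, one_smul] at h1
    exact (hpos 1).trans_le (h1.trans (hM 1 zero_le_one))
  have hGnn : ∀ s t, 0 ≤ s → s ≤ t → 0 ≤ G (s, t) := fun s t hs hst => by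
    rw [hGeq s t hs hst]; exact Torus.scalarL2Sq_nonneg _
  have hGle : ∀ s t, 0 ≤ s → s ≤ t → G (s, t) ≤ Torus.scalarL2Sq h := by
    intro s t hs hst
    have hanti' : Torus.scalarL2Sq (φ s t) ≤ Torus.scalarL2Sq (φ s s) :=
      (hφ s hs).1.antitoneOn_scalarL2Sq hκ.le (Icc_subset_Ici_self : Icc s t ⊆ Ici s)
        (left_mem_Icc.2 hst) (right_mem_Icc.2 hst) hst
    rw [(hφ s hs).2] at hanti'
    rwa [hGeq s t hs hst]
  -- the mean-square hypothesis through the agreement `G = ‖φ‖²`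
  have hMS' : ∀ τ, 0 < τ → s₀ + τ ≤ T →
      ∫ s in s₀..T - τ, G (s, s + τ) ≤ (B + (T - τ - s₀)) * m τ ^ 2 * Torus.scalarL2Sq h := by
    intro τ hτ hτT
    have hle : s₀ ≤ T - τ := by linarith
    have heq : ∫ s in s₀..T - τ, G (s, s + τ) =
        ∫ s in s₀..T - τ, Torus.scalarL2Sq (φ s (s + τ)) :=
      intervalIntegral.integral_congr fun s hs => by
        rw [uIcc_of_le hle] at hs
        exact hGeq s (s + τ) (hs₀.trans hs.1) (by linarith)
    rw [heq]
    exact hMS τ (T - τ) hτ.le hle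
  obtain ⟨hJi, hJle⟩ := integral_weightedRelease_le hGm hanti hpos hM hGnn hGle hMS' hs₀ hB hN hT
  -- the pointwise bound `‖θ(t)‖² ≤ 2 s₀² N + 2 M J(t)`
  have hpt : ∀ t, 0 ≤ t → Torus.scalarL2Sq (θ t) ≤ 2 * s₀ ^ 2 * Torus.scalarL2Sq h +
      2 * M * ∫ τ in Ioc 0 (t - s₀), G (t - τ, t) / m τ := by
    intro t ht
    have hθt : Torus.IsSmooth (θ t) := hθ.smooth_scalar.isSmooth_slice (mem_Ici.2 ht)
    have hrep : √(Torus.scalarL2Sq (θ t)) ^ 2 = ∫ s in (0 : ℝ)..t, ∫ x, φ s t x * θ t x := by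
      rw [Real.sq_sqrt (Torus.scalarL2Sq_nonneg _), ← hId (θ t) hθt t ht]
      exact integral_congr_ae (ae_of_all _ fun x => sq (θ t x))
    have hP : ∀ s, 0 < s → s ≤ t →
        |∫ x, φ s t x * θ t x| ≤ √(G (s, t)) * √(Torus.scalarL2Sq (θ t)) := by
      intro s hs hst
      rw [hGeq s t hs.le hst]
      exact TwohalfdThesis.abs_integral_mul_le
        (((hφ s hs.le).1.smooth_scalar.isSmooth_slice (mem_Ici.2 hst)).memLp 2) (hθt.memLp 2)
    have key := sq_le_of_duhamel_amgm hGm hanti hpos hM hMpos hGnn hGle hs₀ hN ht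
      (Real.sqrt_nonneg _) hrep hP
    rwa [Real.sq_sqrt (Torus.scalarL2Sq_nonneg _)] at key
  -- integrate over `[0, T]`
  have hgI : Integrable (fun t => 2 * s₀ ^ 2 * Torus.scalarL2Sq h +
      2 * M * ∫ τ in Ioc 0 (t - s₀), G (t - τ, t) / m τ) (volume.restrict (Ioc 0 T)) :=
    (integrable_const _).add (hJi.const_mul _)
  rw [intervalIntegral.integral_of_le hT]
  calc ∫ t in Ioc 0 T, Torus.scalarL2Sq (θ t)
      ≤ ∫ t in Ioc 0 T, (2 * s₀ ^ 2 * Torus.scalarL2Sq h +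
          2 * M * ∫ τ in Ioc 0 (t - s₀), G (t - τ, t) / m τ) := by
        refine integral_mono_of_nonneg (ae_of_all _ fun t => Torus.scalarL2Sq_nonneg _) hgI ?_
        exact (ae_restrict_iff' measurableSet_Ioc).2 (ae_of_all _ fun t ht => hpt t ht.1.le)
    _ = 2 * s₀ ^ 2 * Torus.scalarL2Sq h * T +
          2 * M * ∫ t in Ioc 0 T, ∫ τ in Ioc 0 (t - s₀), G (t - τ, t) / m τ := by
        rw [integral_add (integrable_const _) (hJi.const_mul _), setIntegral_const,
          integral_const_mul, Real.volume_real_Ioc_of_le hT, sub_zero, smul_eq_mul]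
        ring
    _ ≤ 2 * s₀ ^ 2 * Torus.scalarL2Sq h * T + 2 * M * ((B + T) * Torus.scalarL2Sq h * M) :=
        add_le_add le_rfl (mul_le_mul_of_nonneg_left hJle (mul_nonneg zero_le_two hMpos.le))
    _ = (2 * s₀ ^ 2 * T + 2 * M ^ 2 * (B + T)) * Torus.scalarL2Sq h := by ring

end Summit.AnomalousDissipation.AnomalousDissipation.Theorems.ScalarAnomalySteadySourceFormal.MeanSquareDuhamelVariance

end
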